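import Literature.NumberTheory.GaloisCohomology.Howard2004.DVRKolyvaginBound
import Literature.NumberTheory.GaloisCohomology.Howard2004.KolyvaginSystemScalars
import Literature.NumberTheory.GaloisCohomology.Howard2004.TowerMorphismPushforward
import HarnessLib

/-!
# `H¹_F(K, A) ⊂ H¹(K, A) = colim_k H¹(K, T/𝔪^{e_k}T)` is stable under the scalars of `R`
# (Howard 2004 §1.6: the coefficient action on the discrete Selmer module) — proofs file

Topic `NumberTheory/GaloisCohomology/Howard2004` (sequel to `DVRKolyvaginBound`: `AdicTower.inc/incLoc/incLocIter/incH1/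
incH1LE/condA/H1A/selmerA`). THEOREMS ONLY: no definition, no named fact, no instance, no `sorry`.

WHY (cell `pub/bsd-print-x9`, shared μ-crux `MuInequalityCoherentPair{OfHoward,OfPrint}`, STUB B `stub_controlGlue`,
DISCRETE half, seat `bsd-line-x10b-p1-w2` g10, claim (DG1)). The typed conclusion of Howard's Thm. 1.6.1
(`DVRSetting.Conclusion`) gives an ADDITIVE bijection `Φ : H¹_F(K, A) ≃ 𝒟 ⊕ M ⊕ M` together with the equivariance
clause `Φ [r • c] = r • Φ [c]` for level classes `c` with `[c], [r • c] ∈ H¹_F(K, A)`; to transport it to an honest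
`R`-module (the `e𝒜` input of `…HeegnerMuPartStabilized.nonempty_specWitness_of_dvrConclusion`) one needs that
`H¹_F(K, A)` IS stable under the levelwise scalar action `r ↦ H¹(r •)` (`galoisCohomology.scalarMapH1`). This file proves
that stability from the `R`-stability of the local conditions (`SatisfiesH.cond_smul`), by pure functoriality:

* `AdicTower.incH1_scalarMapH1`, `incLoc_scalarMapH1`, `incLocIter_scalarMapH1`, `scalarMapH1_comp_incH1LE` — the transition
  maps of `A = colim T/𝔪^{e_k}` (`inc = π^{e_{k+1}-e_k}` on lifts, `R`-linear) commute with the scalars, globally and locally;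
* `AdicTower.localization_incH1` — localisation commutes with `H¹(inc)`;
* `AdicTower.le_condA`, `map_scalarMapH1_condA_le` — the propagated local condition `condA F j v = ⨆_d incLocIter⁻¹(F_{j+d,v})`
  contains `F_{j,v}` and is `R`-stable when every `F_{k,v}` is;
* `AdicTower.scalarMapH1_mem_selmerGroup_condA` — hence the level Selmer groups `H¹_{condA F j}(K, T/𝔪^{e_j})` are `R`-stable;
* **`AdicTower.map_scalarMapH1_mem_selmerA`**, **`AdicTower.of_scalarMapH1_mem_selmerA`** — `H¹_F(K, A)` is stable under the
  action `DirectLimit.map (H¹(r •))` of `r` on `H¹(K, A)`; on representatives: `[c] ∈ H¹_F(K, A) ⇒ [r • c] ∈ H¹_F(K, A)`;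
* `AdicTower.incLoc_cohomologyMap_red_eq_scalarMapH1`, `map_incLoc_le_of_cond_red_of_cond_smul` — `inc ∘ red = π^{e_{k+1}-e_k}`
  on `H¹(K_v, ·)`, so `H¹(inc)` carries `F_{k,v} = red(F_{k+1,v})` into `F_{k+1,v}` (recorded for the sequel; uses `cond_red`);
* `DVRSetting.of_scalarMapH1_mem_selmerA` — the same for a `DVRSetting` with `SatisfiesH` (`F = (S.t ·).cond`).

References: [Howard2004HeegnerKolyvagin] B. Howard, Compositio Math. 140 (2004), Def. 1.1.1 (local conditions are
`R`-submodules), §1.6 / Thm. 1.6.1 (arXiv:1202.6340 p. 5 L20–24, p. 11 L18–28, p. 12 L40–48); [SerreGaloisCohomology1997]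
I §2.2–2.4 (functoriality of `H¹` in the module, compatibility with restriction).  BSD is not proved by any of this.
-/

set_option autoImplicit false

noncomputable section

open Function NumberField IsDedekindDomain Field
open scoped NumberField ContRepresentation

namespace Literature.NumberTheory.GaloisCohomology.Howard2004

open Literature.NumberTheory.GaloisRepresentations
open Literature.NumberTheory.GaloisRepresentations.DiscreteGaloisModule
open Literature.NumberTheory.GaloisRepresentations.galoisCohomology

namespace AdicTower

variable {K : Type} [Field K] [NumberField K] {R : Type} [CommRing R] [IsLocalRing R]
  {N : ℕ → Type} [∀ k, AddCommGroup (N k)] [∀ k, TopologicalSpace (N k)] [∀ k, DiscreteTopology (N k)]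
  [∀ k, Module R (N k)]
  (T : AdicTower K R N) (π : R) (e : ℕ → ℕ)
  (hkill : ∀ k, ∀ r ∈ IsLocalRing.maximalIdeal R ^ e k, ∀ x : N k, r • x = 0)
  (hker : ∀ k, LinearMap.ker (T.red k) = (IsLocalRing.maximalIdeal R ^ e k) • (⊤ : Submodule R (N (k + 1))))
  (hπ : π ∈ IsLocalRing.maximalIdeal R) (he : ∀ k, e k ≤ e (k + 1))

/-! ## §1 The transition maps commute with the scalars -/

omit [NumberField K] in
/-- `H¹(inc_k) (r • c) = r • H¹(inc_k) c` (`inc_k` is `R`-linear). [cite: Howard2004HeegnerKolyvagin, §1.6 (arXiv p. 12, L40–48)]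
[cite: SerreGaloisCohomology1997, Ch. I §2.2] -/
theorem incH1_scalarMapH1 (k : ℕ) (r : R) (c : galoisCohomology (T.ρ k) 1) :
    incH1 T π e hkill hker hπ he k (scalarMapH1 (T.ρ k) (T.hlin k) r c) =
      scalarMapH1 (T.ρ (k + 1)) (T.hlin (k + 1)) r (incH1 T π e hkill hker hπ he k c) :=
  cohomologyMap_scalarMapH1 (T.hlin k) (T.hlin (k + 1)) (inc T π e hkill hker hπ he k)
    (inc_equivariant T π e hkill hker hπ he k) r c

omit [NumberField K] in
/-- `H¹(r •) ∘ incH1LE i j = incH1LE i j ∘ H¹(r •)` for all `i ≤ j` (the shape `DirectLimit.map` wants).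
[cite: Howard2004HeegnerKolyvagin, §1.6 (arXiv p. 12, L40–48)] [cite: SerreGaloisCohomology1997, Ch. I §2.2] -/
theorem scalarMapH1_comp_incH1LE (r : R) :
    ∀ (i j : ℕ) (h : i ≤ j), (scalarMapH1 (T.ρ j) (T.hlin j) r).comp (incH1LE T π e hkill hker hπ he i j h) =
      (incH1LE T π e hkill hker hπ he i j h).comp (scalarMapH1 (T.ρ i) (T.hlin i) r) := by
  intro i j h
  induction h with
  | refl =>
    have h0 : incH1LE T π e hkill hker hπ he i i le_rfl = AddMonoidHom.id _ := Nat.leRec_self _ _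
    rw [h0]
    rfl
  | @step j hle ih =>
    have h1 : incH1LE T π e hkill hker hπ he i (j + 1) (Nat.le.step hle) =
        (incH1 T π e hkill hker hπ he j).comp (incH1LE T π e hkill hker hπ he i j hle) :=
      Nat.leRec_succ _ _ hle
    rw [h1]
    ext c
    simp only [AddMonoidHom.comp_apply]
    rw [← incH1_scalarMapH1]
    exact congrArg (incH1 T π e hkill hker hπ he j) (DFunLike.congr_fun ih c)

/-- `H¹(K_v, inc_k) (r • c) = r • H¹(K_v, inc_k) c`. [cite: Howard2004HeegnerKolyvagin, §1.6 (arXiv p. 11, L18–20)]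
[cite: SerreGaloisCohomology1997, Ch. I §2.2] -/
theorem incLoc_scalarMapH1 (k : ℕ) (v : Place K) (r : R) (c : galoisCohomology ((T.ρ k).toLocal v) 1) :
    incLoc T π e hkill hker hπ he k v
        (scalarMapH1 ((T.ρ k).toLocal v) ((T.hlin k).restrictField _) r c) =
      scalarMapH1 ((T.ρ (k + 1)).toLocal v) ((T.hlin (k + 1)).restrictField _) r
        (incLoc T π e hkill hker hπ he k v c) :=
  cohomologyMap_scalarMapH1 ((T.hlin k).restrictField _) ((T.hlin (k + 1)).restrictField _)
    (inc T π e hkill hker hπ he k) (fun _ x => inc_equivariant T π e hkill hker hπ he k _ x) r c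

/-- `incLocIter j v d (r • c) = r • incLocIter j v d c`. [cite: Howard2004HeegnerKolyvagin, §1.6 (arXiv p. 11, L18–20)]
[cite: SerreGaloisCohomology1997, Ch. I §2.2] -/
theorem incLocIter_scalarMapH1 (j : ℕ) (v : Place K) (r : R) :
    ∀ (d : ℕ) (c : galoisCohomology ((T.ρ j).toLocal v) 1),
      incLocIter T π e hkill hker hπ he j v d (scalarMapH1 ((T.ρ j).toLocal v) ((T.hlin j).restrictField _) r c) =
        scalarMapH1 ((T.ρ (j + d)).toLocal v) ((T.hlin (j + d)).restrictField _) r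
          (incLocIter T π e hkill hker hπ he j v d c)
  | 0, _ => rfl
  | d + 1, c => by
    change incLoc T π e hkill hker hπ he (j + d) v (incLocIter T π e hkill hker hπ he j v d _) =
      scalarMapH1 _ _ r (incLoc T π e hkill hker hπ he (j + d) v (incLocIter T π e hkill hker hπ he j v d c))
    rw [incLocIter_scalarMapH1 j v r d c, incLoc_scalarMapH1]

/-- **Localisation commutes with `H¹(inc)`**: `loc_v (H¹(K, inc_k) c) = H¹(K_v, inc_k) (loc_v c)`.
[cite: Howard2004HeegnerKolyvagin, §1.6 (arXiv p. 11, L18–20)] [cite: SerreGaloisCohomology1997, Ch. I §2.4] -/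
theorem localization_incH1 (k : ℕ) (v : Place K) (c : galoisCohomology (T.ρ k) 1) :
    galoisCohomology.localization (T.ρ (k + 1)) v 1 (incH1 T π e hkill hker hπ he k c) =
      incLoc T π e hkill hker hπ he k v (galoisCohomology.localization (T.ρ k) v 1 c) :=
  localization_cohomologyMap_one _ _ _ _ v c

/-! ## §2 The propagated local conditions `condA` and the scalars -/

/-- `F_{j,v} ≤ condA F j v` (the term `d = 0`). [cite: Howard2004HeegnerKolyvagin, §1.6 (arXiv p. 11, L18–20)] -/
theorem le_condA (F : ∀ k, SelmerStructure (T.ρ k)) (j : ℕ) (v : Place K) :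
    F j v ≤ condA T π e hkill hker hπ he F j v := by
  intro x hx
  refine (AddSubgroup.mem_iSup_of_mem 0 : _ → x ∈ condA T π e hkill hker hπ he F j v) ?_
  exact hx

/-- **`condA F j v` is `R`-stable when every `F_{k,v}` is.** [cite: Howard2004HeegnerKolyvagin, Def. 1.1.1 and §1.6 (arXiv p. 5 L20–24, p. 11 L18–20)] -/
theorem map_scalarMapH1_condA_le (F : ∀ k, SelmerStructure (T.ρ k))
    (hsmul : ∀ (k : ℕ) (v : Place K) (r : R), (F k v).map
      (scalarMapH1 ((T.ρ k).toLocal v) ((T.hlin k).restrictField _) r) ≤ F k v)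
    (j : ℕ) (v : Place K) (r : R) :
    (condA T π e hkill hker hπ he F j v).map (scalarMapH1 ((T.ρ j).toLocal v) ((T.hlin j).restrictField _) r) ≤
      condA T π e hkill hker hπ he F j v := by
  unfold condA
  rw [AddSubgroup.map_iSup]
  refine iSup_mono fun d => ?_
  rintro _ ⟨x, hx, rfl⟩
  rw [AddSubgroup.coe_comap, Set.mem_preimage] at hx
  change incLocIter T π e hkill hker hπ he j v d _ ∈ F (j + d) v
  rw [incLocIter_scalarMapH1]
  exact hsmul (j + d) v r ⟨_, hx, rfl⟩

/-- **The level Selmer groups of `condA F` are `R`-stable** when every `F_{k,v}` is.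
[cite: Howard2004HeegnerKolyvagin, Def. 1.1.1 and §1.6 (arXiv p. 5 L20–24, p. 11 L18–28)] -/
theorem scalarMapH1_mem_selmerGroup_condA (F : ∀ k, SelmerStructure (T.ρ k))
    (hsmul : ∀ (k : ℕ) (v : Place K) (r : R), (F k v).map
      (scalarMapH1 ((T.ρ k).toLocal v) ((T.hlin k).restrictField _) r) ≤ F k v)
    (j : ℕ) (r : R) {c : galoisCohomology (T.ρ j) 1}
    (hc : c ∈ (condA T π e hkill hker hπ he F j).selmerGroup) :
    scalarMapH1 (T.ρ j) (T.hlin j) r c ∈ (condA T π e hkill hker hπ he F j).selmerGroup := by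
  rw [SelmerStructure.mem_selmerGroup_iff] at hc ⊢
  intro v
  rw [localization_scalarMapH1]
  exact map_scalarMapH1_condA_le T π e hkill hker hπ he F hsmul j v r ⟨_, hc v, rfl⟩

/-! ## §3 `H¹_F(K, A)` is `R`-stable -/

omit [NumberField K] in
/-- `DirectLimit.map (H¹(r •))` on a representative: `[c] ↦ [r • c]` (Mathlib `map_apply_of`, recorded in the
`AdicTower` currency; use it by `rw`). [cite: Howard2004HeegnerKolyvagin, §1.6 (arXiv p. 12, L40–48)] -/
theorem map_scalarMapH1_of (r : R) (j : ℕ) (c : galoisCohomology (T.ρ j) 1) :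
    (AddCommGroup.DirectLimit.map (fun k => scalarMapH1 (T.ρ k) (T.hlin k) r)
        (scalarMapH1_comp_incH1LE T π e hkill hker hπ he r)
        (AddCommGroup.DirectLimit.of (fun k => galoisCohomology (T.ρ k) 1) (incH1LE T π e hkill hker hπ he) j c) :
        H1A T π e hkill hker hπ he) =
      AddCommGroup.DirectLimit.of (fun k => galoisCohomology (T.ρ k) 1) (incH1LE T π e hkill hker hπ he) j
        (scalarMapH1 (T.ρ j) (T.hlin j) r c) := by
  rw [AddCommGroup.DirectLimit.map_apply_of]

omit [NumberField K] in
/-- Every class of `H¹(K, A)` is represented at some level: `∃ j c, [c] = a`.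
[cite: Howard2004HeegnerKolyvagin, §1.6 (arXiv p. 12, L40–48)] -/
theorem exists_of_eq (a : H1A T π e hkill hker hπ he) :
    ∃ (j : ℕ) (c : galoisCohomology (T.ρ j) 1),
      AddCommGroup.DirectLimit.of (fun k => galoisCohomology (T.ρ k) 1) (incH1LE T π e hkill hker hπ he) j c = a := by
  induction a using AddCommGroup.DirectLimit.induction_on with
  | ih j c => exact ⟨j, c, rfl⟩

/-- **`H¹_F(K, A)` is stable under the action `DirectLimit.map (H¹(r •))` of `r ∈ R` on `H¹(K, A)`** (when every
`F_{k,v}` is `R`-stable). [cite: Howard2004HeegnerKolyvagin, Def. 1.1.1 and Thm. 1.6.1 (arXiv p. 5 L20–24, p. 11 L18–28, p. 12 L40–48)] -/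
theorem map_scalarMapH1_mem_selmerA (F : ∀ k, SelmerStructure (T.ρ k))
    (hsmul : ∀ (k : ℕ) (v : Place K) (r : R), (F k v).map
      (scalarMapH1 ((T.ρ k).toLocal v) ((T.hlin k).restrictField _) r) ≤ F k v) (r : R)
    {a : H1A T π e hkill hker hπ he} (ha : a ∈ selmerA T π e hkill hker hπ he F) :
    (AddCommGroup.DirectLimit.map (fun k => scalarMapH1 (T.ρ k) (T.hlin k) r)
        (scalarMapH1_comp_incH1LE T π e hkill hker hπ he r) a : H1A T π e hkill hker hπ he) ∈
      selmerA T π e hkill hker hπ he F := by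
  unfold selmerA at ha ⊢
  induction ha using AddSubgroup.iSup_induction' with
  | hp j a ha =>
    obtain ⟨c, hc, rfl⟩ := ha
    refine AddSubgroup.mem_iSup_of_mem j ⟨scalarMapH1 (T.ρ j) (T.hlin j) r c,
      scalarMapH1_mem_selmerGroup_condA T π e hkill hker hπ he F hsmul j r hc, ?_⟩
    rw [map_scalarMapH1_of]
  | h1 => rw [map_zero]; exact zero_mem _
  | hadd a b _ _ iha ihb => rw [map_add]; exact add_mem iha ihb

/-- **On representatives: `[c] ∈ H¹_F(K, A) ⇒ [r • c] ∈ H¹_F(K, A)`** (`[·] = DirectLimit.of _ _ j`).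
[cite: Howard2004HeegnerKolyvagin, Def. 1.1.1 and Thm. 1.6.1 (arXiv p. 5 L20–24, p. 11 L18–28, p. 12 L40–48)] -/
theorem of_scalarMapH1_mem_selmerA (F : ∀ k, SelmerStructure (T.ρ k))
    (hsmul : ∀ (k : ℕ) (v : Place K) (r : R), (F k v).map
      (scalarMapH1 ((T.ρ k).toLocal v) ((T.hlin k).restrictField _) r) ≤ F k v)
    (j : ℕ) (r : R) (c : galoisCohomology (T.ρ j) 1)
    (hc : AddCommGroup.DirectLimit.of (fun k => galoisCohomology (T.ρ k) 1) (incH1LE T π e hkill hker hπ he) j c ∈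
      selmerA T π e hkill hker hπ he F) :
    AddCommGroup.DirectLimit.of (fun k => galoisCohomology (T.ρ k) 1) (incH1LE T π e hkill hker hπ he) j
        (scalarMapH1 (T.ρ j) (T.hlin j) r c) ∈ selmerA T π e hkill hker hπ he F := by
  rw [← map_scalarMapH1_of]
  exact map_scalarMapH1_mem_selmerA T π e hkill hker hπ he F hsmul r hc

/-! ## §4 `inc ∘ red = π^{e_{k+1}-e_k}` on `H¹(K_v, ·)` and the local conditions along `inc` -/

omit [NumberField K] [IsLocalRing R] in
/-- `H¹(r •)` is `H¹` of the additive map `m ↦ r • m` (the two functoriality currencies agree).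
[cite: SerreGaloisCohomology1997, Ch. I §2.2] -/
theorem cohomologyMap_smul_eq_scalarMapH1 {L : Type} [Field L] {M : Type} [AddCommGroup M] [TopologicalSpace M]
    [DiscreteTopology M] [Module R M] (τ : DiscreteGaloisModule L M) (hτ : τ.IsScalarLinear R) (r : R)
    (h : ∀ (g : absoluteGaloisGroup L) (x : M), DistribSMul.toAddMonoidHom M r (τ g x) = τ g (DistribSMul.toAddMonoidHom M r x))
    (c : galoisCohomology τ 1) :
    ContinuousRep.cohomologyMap τ τ (DistribSMul.toAddMonoidHom M r) continuous_of_discreteTopology h 1 c =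
      scalarMapH1 τ hτ r c :=
  rfl

/-- **`H¹(K_v, inc_k) (H¹(K_v, red_k) y) = π^{e_{k+1}-e_k} • y`** (`inc ∘ red = π^{e_{k+1}-e_k}`, `inc_red`).
[cite: Howard2004HeegnerKolyvagin, §1.6 (arXiv p. 11 L18–20, p. 12 L40–48)] -/
theorem incLoc_cohomologyMap_red_eq_scalarMapH1 (k : ℕ) (v : Place K)
    (y : galoisCohomology ((T.ρ (k + 1)).toLocal v) 1) :
    incLoc T π e hkill hker hπ he k v
        (ContinuousRep.cohomologyMap ((T.ρ (k + 1)).toLocal v) ((T.ρ k).toLocal v) (T.red k).toAddMonoidHom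
          continuous_of_discreteTopology (fun _ x => T.red_equivariant k _ x) 1 y) =
      scalarMapH1 ((T.ρ (k + 1)).toLocal v) ((T.hlin (k + 1)).restrictField _) (π ^ (e (k + 1) - e k)) y := by
  have hsm : ∀ (g : absoluteGaloisGroup (Place.Completion v)) (x : N (k + 1)),
      DistribSMul.toAddMonoidHom (N (k + 1)) (π ^ (e (k + 1) - e k)) ((T.ρ (k + 1)).toLocal v g x) =
        (T.ρ (k + 1)).toLocal v g (DistribSMul.toAddMonoidHom (N (k + 1)) (π ^ (e (k + 1) - e k)) x) :=
    fun g x => ((T.hlin (k + 1)).restrictField _ g _ x).symm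
  rw [← cohomologyMap_smul_eq_scalarMapH1 ((T.ρ (k + 1)).toLocal v) ((T.hlin (k + 1)).restrictField _)
    (π ^ (e (k + 1) - e k)) hsm]
  exact cohomologyMap_one_comp_eq _ _ _ _ _ _ _ _ hsm (fun x => inc_red T π e hkill hker hπ he k x) y

/-- **`H¹(K_v, inc_k)` carries `F_{k,v}` into `F_{k+1,v}`** when `F_{k,v} = red(F_{k+1,v})` (`cond_red`) and `F_{k+1,v}`
is `R`-stable (`cond_smul`): `inc(red y) = π^{e_{k+1}-e_k} • y`. [cite: Howard2004HeegnerKolyvagin, Def. 1.1.1, Def. 1.1.3 and §1.6 (arXiv p. 5 L20–45, p. 11 L18–20)] -/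
theorem map_incLoc_le_of_cond_red_of_cond_smul (F : ∀ k, SelmerStructure (T.ρ k))
    (hred : ∀ (k : ℕ) (v : Place K), ((F (k + 1)) v).map
      (ContinuousRep.cohomologyMap ((T.ρ (k + 1)).toLocal v) ((T.ρ k).toLocal v)
        (T.red k).toAddMonoidHom continuous_of_discreteTopology
        (fun _ x => T.red_equivariant k _ x) 1) = F k v)
    (hsmul : ∀ (k : ℕ) (v : Place K) (r : R), (F k v).map
      (scalarMapH1 ((T.ρ k).toLocal v) ((T.hlin k).restrictField _) r) ≤ F k v)
    (k : ℕ) (v : Place K) :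
    (F k v).map (incLoc T π e hkill hker hπ he k v) ≤ F (k + 1) v := by
  rintro _ ⟨x, hx, rfl⟩
  rw [← hred k v] at hx
  obtain ⟨y, hy, rfl⟩ := hx
  rw [incLoc_cohomologyMap_red_eq_scalarMapH1]
  exact hsmul (k + 1) v _ ⟨y, hy, rfl⟩

/-- `incLoc_k (condA F k v) ≤ comap-free form`: `H¹(K_v, inc_k)` carries `F_{k,v}` into `condA F (k+1) v`.
[cite: Howard2004HeegnerKolyvagin, §1.6 (arXiv p. 11, L18–20)] -/
theorem incLoc_mem_condA_of_mem (F : ∀ k, SelmerStructure (T.ρ k))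
    (hred : ∀ (k : ℕ) (v : Place K), ((F (k + 1)) v).map
      (ContinuousRep.cohomologyMap ((T.ρ (k + 1)).toLocal v) ((T.ρ k).toLocal v)
        (T.red k).toAddMonoidHom continuous_of_discreteTopology
        (fun _ x => T.red_equivariant k _ x) 1) = F k v)
    (hsmul : ∀ (k : ℕ) (v : Place K) (r : R), (F k v).map
      (scalarMapH1 ((T.ρ k).toLocal v) ((T.hlin k).restrictField _) r) ≤ F k v)
    (k : ℕ) (v : Place K) {x : galoisCohomology ((T.ρ k).toLocal v) 1} (hx : x ∈ F k v) :
    incLoc T π e hkill hker hπ he k v x ∈ condA T π e hkill hker hπ he F (k + 1) v :=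
  le_condA T π e hkill hker hπ he F (k + 1) v
    (map_incLoc_le_of_cond_red_of_cond_smul T π e hkill hker hπ he F hred hsmul k v ⟨x, hx, rfl⟩)

end AdicTower

/-! ## §5 For a `DVRSetting` with H.0–H.5 -/

namespace DVRSetting

variable {p : ℕ} [Fact p.Prime] {K : Type} [Field K] [NumberField K]
  {R : Type} [CommRing R] [IsDomain R] [IsDiscreteValuationRing R] [Algebra ℤ_[p] R]
  {N : ℕ → Type} [∀ k, AddCommGroup (N k)] [∀ k, TopologicalSpace (N k)] [∀ k, DiscreteTopology (N k)]
  [∀ k, Module R (N k)]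
  {Rk : ℕ → Type} [∀ k, CommRing (Rk k)] [∀ k, IsLocalRing (Rk k)] [∀ k, TopologicalSpace (Rk k)]
  [∀ k, DiscreteTopology (Rk k)] [∀ k, Algebra ℤ_[p] (Rk k)] [∀ k, Algebra R (Rk k)]
  [∀ k, Module (Rk k) (N k)] [∀ k, IsScalarTower R (Rk k) (N k)]
  {Nbar : Type} [AddCommGroup Nbar] [TopologicalSpace Nbar] [DiscreteTopology Nbar] [∀ k, Module (Rk k) Nbar]
  {Nq : ℕ → Finset (HeightOneSpectrum (𝓞 K)) → Type} [∀ k n, AddCommGroup (Nq k n)]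
  [∀ k n, TopologicalSpace (Nq k n)] [∀ k n, DiscreteTopology (Nq k n)] [∀ k n, Module (Rk k) (Nq k n)]
  [∀ k n, Module R (Nq k n)] [∀ k n, IsScalarTower R (Rk k) (Nq k n)]
  (S : DVRSetting p K R N Rk Nbar Nq) (hy : S.SatisfiesH)

/-- **`H¹_F(K, A)` of a `DVRSetting` with H.0–H.5 is `R`-stable, on representatives**: `[c] ∈ H¹_F(K, A) ⇒ [r • c] ∈ H¹_F(K, A)`
(the local conditions are `R`-submodules, `SatisfiesH.cond_smul`). For ANY proofs `hπ`, `he` (those hidden in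
`DVRSetting.Conclusion` included, by proof irrelevance). [cite: Howard2004HeegnerKolyvagin, Def. 1.1.1 and Thm. 1.6.1 (arXiv p. 5 L20–24, p. 11 L18–28)] -/
theorem of_scalarMapH1_mem_selmerA (hπ : S.π ∈ IsLocalRing.maximalIdeal R) (he : ∀ k, S.e k ≤ S.e (k + 1))
    (j : ℕ) (r : R) (c : galoisCohomology (S.T.ρ j) 1)
    (hc : AddCommGroup.DirectLimit.of (fun k => galoisCohomology (S.T.ρ k) 1)
        (AdicTower.incH1LE S.T S.π S.e hy.killed hy.ker_red hπ he) j c ∈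
      S.T.selmerA S.π S.e hy.killed hy.ker_red hπ he fun k => (S.t k).cond) :
    AddCommGroup.DirectLimit.of (fun k => galoisCohomology (S.T.ρ k) 1)
        (AdicTower.incH1LE S.T S.π S.e hy.killed hy.ker_red hπ he) j (scalarMapH1 (S.T.ρ j) (S.T.hlin j) r c) ∈
      S.T.selmerA S.π S.e hy.killed hy.ker_red hπ he fun k => (S.t k).cond :=
  AdicTower.of_scalarMapH1_mem_selmerA S.T S.π S.e hy.killed hy.ker_red hπ he (fun k => (S.t k).cond) hy.cond_smul j r c hc

/-- **`H¹_F(K, A)` of a `DVRSetting` with H.0–H.5 is stable under `DirectLimit.map (H¹(r •))`.**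
[cite: Howard2004HeegnerKolyvagin, Def. 1.1.1 and Thm. 1.6.1 (arXiv p. 5 L20–24, p. 11 L18–28)] -/
theorem map_scalarMapH1_mem_selmerA (hπ : S.π ∈ IsLocalRing.maximalIdeal R) (he : ∀ k, S.e k ≤ S.e (k + 1)) (r : R)
    {a : AdicTower.H1A S.T S.π S.e hy.killed hy.ker_red hπ he}
    (ha : a ∈ S.T.selmerA S.π S.e hy.killed hy.ker_red hπ he fun k => (S.t k).cond) :
    (AddCommGroup.DirectLimit.map (fun k => scalarMapH1 (S.T.ρ k) (S.T.hlin k) r)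
        (AdicTower.scalarMapH1_comp_incH1LE S.T S.π S.e hy.killed hy.ker_red hπ he r) a :
        AdicTower.H1A S.T S.π S.e hy.killed hy.ker_red hπ he) ∈
      S.T.selmerA S.π S.e hy.killed hy.ker_red hπ he fun k => (S.t k).cond :=
  AdicTower.map_scalarMapH1_mem_selmerA S.T S.π S.e hy.killed hy.ker_red hπ he (fun k => (S.t k).cond)
    hy.cond_smul r ha

/-- `H¹(K_v, inc_k)` carries the level-`k` local condition into the level-`(k+1)` one (`cond_red` + `cond_smul`).
[cite: Howard2004HeegnerKolyvagin, Def. 1.1.1, Def. 1.1.3 and §1.6 (arXiv p. 5 L20–45, p. 11 L18–20)] -/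
theorem map_incLoc_cond_le (hπ : S.π ∈ IsLocalRing.maximalIdeal R) (he : ∀ k, S.e k ≤ S.e (k + 1))
    (k : ℕ) (v : Place K) :
    ((S.t k).cond v).map (AdicTower.incLoc S.T S.π S.e hy.killed hy.ker_red hπ he k v) ≤ (S.t (k + 1)).cond v :=
  AdicTower.map_incLoc_le_of_cond_red_of_cond_smul S.T S.π S.e hy.killed hy.ker_red hπ he (fun k => (S.t k).cond)
    hy.cond_red hy.cond_smul k v

end DVRSetting

end Literature.NumberTheory.GaloisCohomology.Howard2004

end
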